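import Mathlib
import Summits.QuantumFields.BalabanUV.Beta.DecouplingResummation110

/-!
# [Balaban1988RG2Cluster] (1.9) = (1.10) p. 4 WITH THE SUPPORT HYPOTHESIS ON THE CLOSED POLYDISC `|s(Δ)| ≤ e^{κ₁}` ONLY —
# the `σ`-terms of the Cauchy representation (1.23) read the integrand only on the closed polydisc; idle-variable vanishing
# and the resummation over connected domains under polydisc hypotheses; the radial clamp (data on the polydisc extend to
# global data with the same terms) — a faithfulness refinement of the sibling `DecouplingResummation110`
# (cell topic `Summits/QuantumFields/BalabanUV/Beta`; row-D4 terminal leaf (T4)(b))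

HONEST FRAMING (cell rule).  Discharging `BetaPertH` makes Bałaban's UV stability UNCONDITIONAL — a real
constructive-QFT result; NOT the continuum limit, NOT the Clay problem.  This module discharges NOTHING of `BetaPertH`.
PURPOSE.  The sibling `DecouplingResummation110` (p204386) states its support hypothesis `SupportedOnRootComp` — and the
siblings `DecouplingSupport110` (p204556) ∕ `DecouplingSupportFixedPoint110` their idleness notions — for ALL complex
parameter vectors vanishing off `σ`.  For the `s`-weighted walk sums (polynomials in the parameters) this is harmless;
but Bałaban's fixed points `D(H(s), ·)`, `𝐀₀(s)` of (1.3)–(1.4) exist only on the polydisc — [II] p. 5: *"the parameters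
s(Y₀) are complex valued and satisfy the bound |s(Δ)| ≦ e^{κ₁}"*, p. 6: *"𝐇_k(s(Y₀), B′)) is an analytic function of
s(Y₀), B, for |s(Y₀)| ≦ e^{κ₁} and g_k|B| < ε₁"*.  This module shows, in the kernel, that NOTHING outside the closed
polydisc is ever read: (i) the iterated operation `B13Sect1Arith.cauchyOp` reads its integrand only on a parameter set
closed under the moves it actually performs (`s(Δ) ∈ [0,1]`, `|σ(Δ)| = ρ`); (ii) the vanishing of the disconnected
`σ`-terms and the resummation (1.9) = (1.10) hold under the support hypothesis restricted to the closed polydisc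
(`SupportedOnRootCompOn ρ`); (iii) the radial clamp onto the closed disc commutes with the coordinate moves, preserves
«s(σᶜ) = 0», and leaves every `σ`-term unchanged — so any family of objects given on the polydisc (fixed points, their
equations, their block-separability) yields, by precomposition with the clamp, GLOBAL data to which the siblings' globally
quantified theorems apply verbatim.  [folklore]; NOT summit progress.  Unit `b2b-balaban-beta-an4-g34` (owner of
`BINDER-OWNERS.md` row D4); cell `GAPS.md` C-an4-70.

CITATION HEADER (lean-in-tree rule).  [II] = T. Bałaban, *Renormalization group approach to lattice gauge field theories.
II. Cluster expansions*, Commun. Math. Phys. **116**, 1–22 (1988) [Balaban1988RG2Cluster] (journal page = PDF page;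
renders `HOME/b2b-balaban-ref1/pages/1988-cmp116-rg-II-cluster/…-p004-x2.png`, `…-p005-x2.png`, `…-p006-x2.png`,
`…-p007-x2.png` READ AS IMAGES by this unit); the passages are those quoted in the sibling's header ((1.9), (1.10) p. 4,
(1.23) p. 7 *"the σ(Δ)-integrations are over the circles |σ(Δ)| = e^{κ₁}"*) and the two sentences above (p. 5, p. 6).

WHAT IS CERTIFIED HERE (kernel, sorry-free; [folklore]).
§1 `MovesClosedOn ρ Q l` (closure under the performed moves only); **`cauchyOp_congr_on`** (integrands agreeing on `Q`
   have equal iterated operations on `Q` — `intervalIntegral.integral_congr` on `[0,1]`, `circleIntegral.integral_congr`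
   on the sphere); `IdleOnBall` (idleness on `Q` for values `|z| ≤ ρ`), `idleOnBall_cauchyOp`,
   **`cauchyOp_eq_zero_of_idleOnBall`** (the polydisc form of the sibling's idle-variable vanishing; `ρ ≥ 0`).
§2 `ZeroOffBall ρ σ` (vanishing off `σ`, all coordinates in the closed disc), `movesClosedOn_zeroOffBall`;
   **`term19_congr_polyBall`** (integrands agreeing on the closed polydisc have the same `σ`-terms); `SupportedOnRootCompOn`
   (+ `.of_global`); `term19_eq_zero_of_not_wallConnected_on`; **`sum_term19_eq_sum_connected_on`** — (1.9) = (1.10) with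
   the support hypothesis on the closed polydisc only.
§3 `clamp ρ` (radial clamp onto `|z| ≤ ρ`: `clamp_of_le`, `clamp_mem`, `clamp_zero`), `clampVec`, `clampVec_update`
   (commutes with coordinate updates), **`term19_clampVec`** (`term19 ρ (F ∘ clampVec ρ) σ = term19 ρ F σ`),
   **`supportedOnRootComp_clampVec`** (polydisc support hypothesis for `F` ⟹ GLOBAL support hypothesis for
   `F ∘ clampVec ρ`).

NOT CLAIMED.  Anything about Bałaban's integrands (the polydisc analyticity and the support property are hypotheses);
every bound; the dictionary; NOT summit progress.  MODEL CONVENTIONS: as in the sibling (`ρ = e^{κ₁}` in print; here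
any `ρ ≥ 0`; `E` complete where integrals are evaluated).
-/

namespace Summit.QuantumFields.BalabanUV.Beta.DecouplingResummation110Polydisc

open Literature.MathematicalPhysics.QuantumFieldTheory.Balaban1983to89.B13Sect1Arith (cauchyOp)
open Literature.MathematicalPhysics.QuantumFieldTheory.Balaban1983to89.B14DomainGeom (Pt)
open Literature.MathematicalPhysics.QuantumFieldTheory.Balaban1983to89.B13Factor210 (WallConnected)
open Summit.QuantumFields.BalabanUV.Beta.DecouplingResummation110 (rootComp exists_not_mem_rootComp term19
  SupportedOnRootComp sum_powerset_eq_sum_connected circleIntegral_inv_sq_smul_const)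
open Metric Set Complex

noncomputable section

/-! ## §1 The iterated operation reads the integrand only where the moves lead -/

section Moves

variable {ι : Type*} [DecidableEq ι] {E : Type*} [NormedAddCommGroup E] [NormedSpace ℂ E]

/-- A parameter set closed under the moves ACTUALLY PERFORMED by the iterated operation of (1.23) over the list `l`:
the real coordinate goes to `[0, 1]`, the complex one to the circle `|z| = ρ`. [folklore] -/
def MovesClosedOn (ρ : ℝ) (Q : (ι → ℝ) → (ι → ℂ) → Prop) (l : List ι) : Prop :=
  ∀ s σ, Q s σ → ∀ i ∈ l, ∀ u ∈ Icc (0:ℝ) 1, ∀ z ∈ sphere (0:ℂ) ρ, Q (Function.update s i u) (Function.update σ i z)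

/-- A set closed under the moves of `i :: l` is closed under the moves of `l`. [folklore] -/
theorem MovesClosedOn.tail {ρ : ℝ} {Q : (ι → ℝ) → (ι → ℂ) → Prop} {i : ι} {l : List ι}
    (hQ : MovesClosedOn ρ Q (i :: l)) : MovesClosedOn ρ Q l :=
  fun s σ hs j hj u hu z hz => hQ s σ hs j (List.mem_cons_of_mem i hj) u hu z hz

/-- **THE ITERATED OPERATION READS THE INTEGRAND ONLY ON A MOVES-CLOSED SET**: two integrands agreeing on `Q` give the
same iterated operation at every point of `Q`. [folklore] -/
theorem cauchyOp_congr_on {ρ : ℝ} (hρ : 0 ≤ ρ) {Q : (ι → ℝ) → (ι → ℂ) → Prop} :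
    ∀ (l : List ι), MovesClosedOn ρ Q l → ∀ {h h' : (ι → ℝ) → (ι → ℂ) → E},
      (∀ s σ, Q s σ → h s σ = h' s σ) → ∀ s σ, Q s σ → cauchyOp ρ l h s σ = cauchyOp ρ l h' s σ
  | [], _, _, _, hh, s, σ, hs => by simpa [cauchyOp] using hh s σ hs
  | i :: l, hQ, h, h', hh, s, σ, hs => by
    have IH := cauchyOp_congr_on hρ l hQ.tail hh
    simp only [cauchyOp]
    refine intervalIntegral.integral_congr fun u hu => ?_
    rw [uIcc_of_le zero_le_one] at hu
    congr 1
    refine circleIntegral.integral_congr hρ fun z hz => ?_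
    simp only [IH _ _ (hQ s σ hs i List.mem_cons_self u hu z hz)]

/-- Idleness in the variable `σ(i)` ON `Q`, for values in the closed disc `|z| ≤ ρ` only. [folklore] -/
def IdleOnBall (ρ : ℝ) (Q : (ι → ℝ) → (ι → ℂ) → Prop) (i : ι) (h : (ι → ℝ) → (ι → ℂ) → E) : Prop :=
  ∀ s σ, Q s σ → ∀ z ∈ closedBall (0:ℂ) ρ, h s (Function.update σ i z) = h s σ

/-- Restricted idleness propagates through the iterated operation (values on the circle suffice). [folklore] -/
theorem idleOnBall_cauchyOp {ρ : ℝ} (hρ : 0 ≤ ρ) {Q : (ι → ℝ) → (ι → ℂ) → Prop} {i : ι} :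
    ∀ (l : List ι), MovesClosedOn ρ Q l → ∀ {h : (ι → ℝ) → (ι → ℂ) → E}, IdleOnBall ρ Q i h →
      IdleOnBall ρ Q i (cauchyOp ρ l h)
  | [], _, h, hh => by simpa [cauchyOp] using hh
  | j :: l, hQ, h, hh => by
    intro s σ hs z hz
    have IH := idleOnBall_cauchyOp hρ l hQ.tail hh
    simp only [cauchyOp]
    by_cases hji : j = i
    · subst hji
      simp only [Function.update_idem]
    · refine intervalIntegral.integral_congr fun u hu => ?_
      rw [uIcc_of_le zero_le_one] at hu
      congr 1
      refine circleIntegral.integral_congr hρ fun w hw => ?_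
      have e1 : Function.update (Function.update σ i z) j w = Function.update (Function.update σ j w) i z :=
        Function.update_comm (Ne.symm hji) _ _ _
      have e2 := IH _ _ (hQ s σ hs j List.mem_cons_self u hu w hw) z hz
      simp only [e1, e2]

/-- **IDLE-VARIABLE VANISHING, POLYDISC FORM**: as `DecouplingResummation110.cauchyOp_eq_zero_of_idleOn`, with idleness
demanded only on `Q` and only for values `|z| ≤ ρ`, and `Q` closed only under the moves actually performed.
[cite: Balaban1988RG2Cluster, p.4 before (1.10)] -/
theorem cauchyOp_eq_zero_of_idleOnBall [CompleteSpace E] {ρ : ℝ} (hρ : 0 ≤ ρ) {Q : (ι → ℝ) → (ι → ℂ) → Prop}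
    {i : ι} : ∀ (l : List ι), MovesClosedOn ρ Q l → i ∈ l → ∀ {h : (ι → ℝ) → (ι → ℂ) → E}, IdleOnBall ρ Q i h →
      ∀ s σ, Q s σ → cauchyOp ρ l h s σ = 0
  | [], _, hi, _, _ => by simp at hi
  | j :: l, hQ, hi, h, hh => by
    intro s σ hs
    simp only [cauchyOp]
    have hρs : ((ρ : ℝ) : ℂ) ∈ sphere (0:ℂ) ρ := by simp [abs_of_nonneg hρ]
    by_cases hji : j = i
    · subst hji
      have hidle := idleOnBall_cauchyOp hρ l hQ.tail hh
      have hzero : ∀ u ∈ uIcc (0:ℝ) 1, (2 * Real.pi * I : ℂ)⁻¹ • (∮ w in C(0, ρ), ((w - (u : ℂ)) ^ 2)⁻¹ •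
          cauchyOp ρ l h (Function.update s j u) (Function.update σ j w)) = 0 := by
        intro u hu
        rw [uIcc_of_le zero_le_one] at hu
        have hconst : EqOn (fun w => ((w - (u : ℂ)) ^ 2)⁻¹ •
              cauchyOp ρ l h (Function.update s j u) (Function.update σ j w))
            (fun w => ((w - (u : ℂ)) ^ 2)⁻¹ •
              cauchyOp ρ l h (Function.update s j u) (Function.update σ j (ρ : ℂ))) (sphere (0:ℂ) ρ) := by
          intro w hw
          have := hidle _ _ (hQ s σ hs j List.mem_cons_self u hu _ hρs) w (sphere_subset_closedBall hw)
          simp only [Function.update_idem] at this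
          simp only [this]
        rw [circleIntegral.integral_congr hρ hconst, circleIntegral_inv_sq_smul_const, smul_zero]
      rw [intervalIntegral.integral_congr hzero]
      simp
    · have hil : i ∈ l := by simpa [Ne.symm hji] using hi
      have IH := cauchyOp_eq_zero_of_idleOnBall hρ l hQ.tail hil hh
      have hzero : ∀ u ∈ uIcc (0:ℝ) 1, (2 * Real.pi * I : ℂ)⁻¹ • (∮ w in C(0, ρ), ((w - (u : ℂ)) ^ 2)⁻¹ •
          cauchyOp ρ l h (Function.update s j u) (Function.update σ j w)) = 0 := by
        intro u hu
        rw [uIcc_of_le zero_le_one] at hu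
        have hc : EqOn (fun w => ((w - (u : ℂ)) ^ 2)⁻¹ •
              cauchyOp ρ l h (Function.update s j u) (Function.update σ j w)) (fun _ => 0) (sphere (0:ℂ) ρ) := by
          intro w hw
          simp only [IH _ _ (hQ s σ hs j List.mem_cons_self u hu w hw), smul_zero]
        rw [circleIntegral.integral_congr hρ hc]
        simp [circleIntegral]
      rw [intervalIntegral.integral_congr hzero]
      simp

end Moves

/-! ## §2 The `σ`-terms read the integrand only on the closed polydisc; the END with polydisc hypotheses -/

section Polydisc

variable {d : ℕ} {E : Type*} [NormedAddCommGroup E] [NormedSpace ℂ E]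

/-- The parameter vectors of the `σ`-term INSIDE THE CLOSED POLYDISC: complex coordinates vanishing off `σ` and all of
modulus `≤ ρ` ([II] p. 5: *"the parameters s(Y₀) are complex valued and satisfy the bound |s(Δ)| ≦ e^{κ₁}"*).
[cite: Balaban1988RG2Cluster, p.5 before (1.11)] -/
def ZeroOffBall (ρ : ℝ) (σ : Finset (Pt d)) : (Pt d → ℝ) → (Pt d → ℂ) → Prop :=
  fun _ τ => (∀ Δ, Δ ∉ σ → τ Δ = 0) ∧ ∀ Δ, τ Δ ∈ closedBall (0:ℂ) ρ

omit [NormedAddCommGroup E] [NormedSpace ℂ E] in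
/-- `ZeroOffBall ρ σ` is closed under the moves over the cubes of `σ`. [folklore] -/
theorem movesClosedOn_zeroOffBall (ρ : ℝ) (σ : Finset (Pt d)) : MovesClosedOn ρ (ZeroOffBall ρ σ) σ.toList := by
  intro s τ hτ i hi u _ z hz
  have hiσ : i ∈ σ := Finset.mem_toList.1 hi
  refine ⟨fun Δ hΔ => ?_, fun Δ => ?_⟩
  · have hne : Δ ≠ i := fun h => hΔ (h ▸ hiσ)
    simp only [Function.update_of_ne hne]
    exact hτ.1 Δ hΔ
  · by_cases h : Δ = i
    · subst h; simpa using sphere_subset_closedBall hz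
    · rw [Function.update_of_ne h]; exact hτ.2 Δ

/-- **THE TERMS READ THE INTEGRAND ONLY ON THE CLOSED POLYDISC**: two integrands agreeing at every vector with all
coordinates in `|z| ≤ ρ` have the same `σ`-terms. [folklore] -/
theorem term19_congr_polyBall {ρ : ℝ} (hρ : 0 ≤ ρ) {F G : (Pt d → ℂ) → E}
    (hFG : ∀ τ : Pt d → ℂ, (∀ Δ, τ Δ ∈ closedBall (0:ℂ) ρ) → F τ = G τ) (σ : Finset (Pt d)) :
    term19 ρ F σ = term19 ρ G σ :=
  cauchyOp_congr_on hρ σ.toList (movesClosedOn_zeroOffBall ρ σ) (fun _ τ hτ => hFG τ hτ.2) 0 0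
    ⟨fun _ _ => rfl, fun _ => by simpa using hρ⟩

/-- THE SUPPORT HYPOTHESIS ON THE POLYDISC: as `SupportedOnRootComp`, but idleness is demanded only at parameter
vectors in the closed polydisc `|τ(Δ)| ≤ ρ` and only for values `|z| ≤ ρ` — the domain on which Bałaban's objects
(the contractions of (1.3)–(1.4), p. 5) exist. [cite: Balaban1988RG2Cluster, p.4 before (1.10)] -/
def SupportedOnRootCompOn (ρ : ℝ) (F : (Pt d → ℂ) → E) (R σ₀ : Finset (Pt d)) (a₀ : Pt d) : Prop :=
  ∀ σ, σ ⊆ σ₀ → ∀ Δ' ∈ σ, Δ' ∉ rootComp R σ a₀ →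
    ∀ τ : Pt d → ℂ, (∀ Δ, Δ ∉ σ → τ Δ = 0) → (∀ Δ, τ Δ ∈ closedBall (0:ℂ) ρ) →
      ∀ z ∈ closedBall (0:ℂ) ρ, F (Function.update τ Δ' z) = F τ

omit [NormedAddCommGroup E] [NormedSpace ℂ E] in
/-- The global support hypothesis of the sibling implies the polydisc one. [folklore] -/
theorem SupportedOnRootCompOn.of_global {ρ : ℝ} {F : (Pt d → ℂ) → E} {R σ₀ : Finset (Pt d)} {a₀ : Pt d}
    (h : SupportedOnRootComp F R σ₀ a₀) : SupportedOnRootCompOn ρ F R σ₀ a₀ :=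
  fun σ hσ Δ' hΔ' hY τ hτ _ z _ => h σ hσ Δ' hΔ' hY τ hτ z

/-- A `σ`-term whose domain is not connected vanishes, under the POLYDISC support hypothesis.
[cite: Balaban1988RG2Cluster, p.4 before (1.10)] -/
theorem term19_eq_zero_of_not_wallConnected_on [CompleteSpace E] {ρ : ℝ} (hρ : 0 ≤ ρ) {F : (Pt d → ℂ) → E}
    {R σ₀ : Finset (Pt d)} {a₀ : Pt d} (hR : WallConnected (↑R : Set (Pt d))) (ha₀ : a₀ ∈ R)
    (hF : SupportedOnRootCompOn ρ F R σ₀ a₀) {σ : Finset (Pt d)} (hσ : σ ⊆ σ₀)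
    (hnc : ¬ WallConnected (↑(R ∪ σ) : Set (Pt d))) : term19 ρ F σ = 0 := by
  obtain ⟨Δ', hΔ'σ, hΔ'⟩ := exists_not_mem_rootComp hR ha₀ hnc
  have hidle : IdleOnBall ρ (ZeroOffBall ρ σ) Δ' (fun (_ : Pt d → ℝ) (τ : Pt d → ℂ) => F τ) :=
    fun _ τ hτ z hz => hF σ hσ Δ' hΔ'σ hΔ' τ hτ.1 hτ.2 z hz
  exact cauchyOp_eq_zero_of_idleOnBall hρ σ.toList (movesClosedOn_zeroOffBall ρ σ) (Finset.mem_toList.2 hΔ'σ)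
    hidle 0 0 ⟨fun _ _ => rfl, fun _ => by simpa using hρ⟩

open Classical in
/-- **(1.9) = (1.10) WITH THE SUPPORT HYPOTHESIS ON THE CLOSED POLYDISC ONLY** (`ρ ≥ 0`; in print `ρ = e^{κ₁}`).
[cite: Balaban1988RG2Cluster, (1.10) p.4] -/
theorem sum_term19_eq_sum_connected_on [CompleteSpace E] {ρ : ℝ} (hρ : 0 ≤ ρ) {F : (Pt d → ℂ) → E}
    {R σ₀ : Finset (Pt d)} {a₀ : Pt d} (hR : WallConnected (↑R : Set (Pt d))) (ha₀ : a₀ ∈ R)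
    (hF : SupportedOnRootCompOn ρ F R σ₀ a₀) :
    ∑ σ ∈ σ₀.powerset, term19 ρ F σ
      = ∑ σ ∈ σ₀.powerset with WallConnected (↑(R ∪ σ) : Set (Pt d)), term19 ρ F σ :=
  sum_powerset_eq_sum_connected R σ₀ (term19 ρ F)
    fun _ hσ hnc => term19_eq_zero_of_not_wallConnected_on hρ hR ha₀ hF hσ hnc

end Polydisc

/-! ## §3 The radial clamp: data on the polydisc extend to global data with the same terms -/

section Clamp

variable {d : ℕ} {E : Type*}

/-- The RADIAL CLAMP onto the closed disc `|z| ≤ ρ`. [folklore] -/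
def clamp (ρ : ℝ) (z : ℂ) : ℂ := if ‖z‖ ≤ ρ then z else ((ρ / ‖z‖ : ℝ) : ℂ) * z

/-- On the disc the clamp is the identity. [folklore] -/
theorem clamp_of_le {ρ : ℝ} {z : ℂ} (hz : ‖z‖ ≤ ρ) : clamp ρ z = z := by simp [clamp, hz]

/-- The clamp lands in the closed disc (`ρ ≥ 0`). [folklore] -/
theorem clamp_mem {ρ : ℝ} (hρ : 0 ≤ ρ) (z : ℂ) : clamp ρ z ∈ closedBall (0:ℂ) ρ := by
  unfold clamp
  split_ifs with h
  · simpa using h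
  · have hz : 0 < ‖z‖ := lt_of_le_of_lt hρ (lt_of_not_ge h)
    rw [mem_closedBall, dist_zero_right, norm_mul, Complex.norm_real, Real.norm_eq_abs,
      abs_of_nonneg (div_nonneg hρ hz.le), div_mul_cancel₀ _ hz.ne']

/-- `clamp ρ 0 = 0` (`ρ ≥ 0`). [folklore] -/
theorem clamp_zero {ρ : ℝ} (hρ : 0 ≤ ρ) : clamp ρ 0 = 0 := clamp_of_le (by simpa using hρ)

/-- The coordinatewise clamp of a parameter vector. [folklore] -/
def clampVec (ρ : ℝ) (τ : Pt d → ℂ) : Pt d → ℂ := fun Δ => clamp ρ (τ Δ)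

/-- The coordinatewise clamp commutes with coordinate updates. [folklore] -/
theorem clampVec_update (ρ : ℝ) (τ : Pt d → ℂ) (Δ' : Pt d) (z : ℂ) :
    clampVec ρ (Function.update τ Δ' z) = Function.update (clampVec ρ τ) Δ' (clamp ρ z) := by
  funext Δ
  by_cases h : Δ = Δ'
  · subst h; simp [clampVec]
  · simp [clampVec, Function.update_of_ne h]

/-- **SAME TERMS**: the integrand precomposed with the clamp has the same `σ`-terms (`ρ ≥ 0`). [folklore] -/
theorem term19_clampVec [NormedAddCommGroup E] [NormedSpace ℂ E] {ρ : ℝ} (hρ : 0 ≤ ρ) (F : (Pt d → ℂ) → E)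
    (σ : Finset (Pt d)) : term19 ρ (fun τ => F (clampVec ρ τ)) σ = term19 ρ F σ :=
  term19_congr_polyBall hρ (fun τ hτ => by
    have : clampVec ρ τ = τ := funext fun Δ => clamp_of_le (by simpa using hτ Δ)
    rw [this]) σ

/-- **GLOBAL FROM POLYDISC**: if `F` satisfies the support hypothesis on the closed polydisc, then `F ∘ clampVec ρ`
satisfies the sibling's GLOBAL support hypothesis — so every theorem of the siblings stated with global idleness applies
to data living on the polydisc, through the clamp, with unchanged terms (`term19_clampVec`). [folklore] -/
theorem supportedOnRootComp_clampVec {ρ : ℝ} (hρ : 0 ≤ ρ) {F : (Pt d → ℂ) → E} {R σ₀ : Finset (Pt d)}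
    {a₀ : Pt d} (hF : SupportedOnRootCompOn ρ F R σ₀ a₀) :
    SupportedOnRootComp (fun τ => F (clampVec ρ τ)) R σ₀ a₀ := by
  intro σ hσ Δ' hΔ' hY τ hτ z
  simp only [clampVec_update]
  refine hF σ hσ Δ' hΔ' hY (clampVec ρ τ) (fun Δ hΔ => ?_) (fun Δ => clamp_mem hρ _) _ (clamp_mem hρ z)
  simp [clampVec, hτ Δ hΔ, clamp_zero hρ]

end Clamp

end

end Summit.QuantumFields.BalabanUV.Beta.DecouplingResummation110Polydisc
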